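import Literature.Probability.Percolation.BoxCrossingSteps
import HarnessLib

/-!
# Box crossings of isoradial square lattices: the iteration of Corollary 6.2 — III. Stacking

Grimmett–Manolescu, *Bond percolation on isoradial graphs* (PTRF 159 (2014) 273–327 =
arXiv:1204.0505), §6.1 (Prop. 6.1, vertical half: hypothesis (b) of Lemma 4.3 from Prop. 6.8) and
§2.3 / [GM13, Prop. 4.2] (box crossings of all shapes from flat vertical crossings and long
horizontal ones, by the Harris–FKG inequality). In the vocabulary of `BoxCrossingIteration`:

* `flat_tbBound` — from the conclusion of Proposition 6.8 (as a hypothesis, in the exact form of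
  `VerticalTransportHonest.vertical_transport` with a constant `θ ∈ (0, 1]`) and uniform bounds for
  top–bottom crossings of squares in the source class: every lattice of the target class crosses
  the flat boxes `W'(N) × u(N)` (`u = ⌊θN/2⌋`, `W' = 2(3N+u+2) + 1`) vertically with probability
  `≥ θ c_V / 2`, at every position;
* `tbLower_of_vTransport` — **stacking**: with the left–right bounds of every aspect ratio for the
  target class (Prop. 6.1, horizontal half), chaining in the transposed class
  (`prod_le_measureReal_chain`, `Symmetries`) yields uniform bounds for top–bottom crossings of
  `n × 2n` boxes of the target class.

## References

* G. R. Grimmett, I. Manolescu, PTRF 159 (2014), arXiv:1204.0505, §6.1, §6.3 (Prop. 6.8), §2.3.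
-/

noncomputable section

namespace Literature.Probability.Percolation

open LatticeModels StarTriangle Real MeasureTheory Complex

namespace TrackExchange

/-! ### Translation to an arbitrary position (top–bottom) -/

/-- **Bounds at two adjacent base positions give bounds everywhere**, top–bottom version. [folklore] -/
theorem tb_bound_everywhere {Ct : Set ((ℤ → ℝ) × (ℤ → ℝ))}
    (hshift : ∀ p ∈ Ct, ∀ s t : ℤ, ((fun i => p.1 (i - s)), (fun j => p.2 (j - t))) ∈ Ct)
    {c : ℝ} {A₀ : ℤ} {a b : ℕ}
    (h : ∀ p ∈ Ct, c ≤ (Pgm p.1 p.2).real (tbEvt A₀ 0 a b) ∧ c ≤ (Pgm p.1 p.2).real (tbEvt (A₀ + 1) 0 a b))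
    (p : (ℤ → ℝ) × (ℤ → ℝ)) (hp : p ∈ Ct) (A B : ℤ) : c ≤ (Pgm p.1 p.2).real (tbEvt A B a b) := by
  obtain ⟨k, hk⟩ : ∃ k : ℤ, (A₀ - A - B = 2 * k) ∨ (A₀ + 1 - A - B = 2 * k) := by
    rcases Int.even_or_odd (A₀ - A - B) with ⟨k, hk⟩ | ⟨k, hk⟩
    · exact ⟨k, Or.inl (by omega)⟩
    · exact ⟨k + 1, Or.inr (by omega)⟩
  rcases hk with hk | hk
  · set t : Site 2 := ![k, -k - B] with ht
    have hct : col t = A₀ - A := by simp [col, ht]; omega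
    have hht : hgtOf t = -B := by simp [hgtOf, ht]; ring
    have key := (h _ (hshift p hp (col t) (hgtOf t))).1
    rw [tbEvt, measureReal_embTBCrossing_shift p.1 p.2 t]
    convert key using 3
    unfold tbEvt; congr 1; funext v
    simp only [zDia, hct, hht]; push_cast; ring
  · set t : Site 2 := ![k, -k - B] with ht
    have hct : col t = A₀ + 1 - A := by simp [col, ht]; omega
    have hht : hgtOf t = -B := by simp [hgtOf, ht]; ring
    have key := (h _ (hshift p hp (col t) (hgtOf t))).2
    rw [tbEvt, measureReal_embTBCrossing_shift p.1 p.2 t]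
    convert key using 3
    unfold tbEvt; congr 1; funext v
    simp only [zDia, hct, hht]; push_cast; ring

/-! ### Flat vertical crossings from Proposition 6.8 -/

/-- The height of the flat boxes: `u(N) = ⌊θN/2⌋`. [cite: GrimmettManolescu2014Isoradial, §6.3 (δN in Prop. 6.8)] -/
def uFlat (θ : ℝ) (N : ℕ) : ℕ := ⌊θ * N / 2⌋₊

/-- The width of the flat boxes: `W'(N) = 2(3N + u + 2) + 1`. [cite: GrimmettManolescu2014Isoradial, §6.3 (B(4N, δN) in Prop. 6.8)] -/
def wFlat (θ : ℝ) (N : ℕ) : ℕ := 2 * (3 * N + uFlat θ N + 2) + 1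

/-- `u(N) ≤ θN/2`. [folklore] -/
theorem uFlat_le {θ : ℝ} (hθ : 0 ≤ θ) (N : ℕ) : (uFlat θ N : ℝ) ≤ θ * N / 2 := Nat.floor_le (by positivity)

/-- `u(N) ≥ θN/2 - 1`. [folklore] -/
theorem uFlat_ge (θ : ℝ) (N : ℕ) : θ * N / 2 - 1 ≤ (uFlat θ N : ℝ) := by
  have := Nat.lt_floor_add_one (θ * N / 2); unfold uFlat; linarith

/-- **Flat vertical crossings of the target class** (Prop. 6.8 + (b) of Lemma 4.3): with the
conclusion of Prop. 6.8 for the constant `θ` and bounds `c_V` for vertical crossings of squares in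
the source class, every target lattice crosses the `W'(N) × u(N)` boxes vertically with
probability `≥ θ c_V / 2`, for `N ≥ N₂`, at every position. [cite: GrimmettManolescu2014Isoradial, §6.3 Prop. 6.8, §6.1] -/
theorem flat_tbBound {ε θ : ℝ} (hθ : 0 < θ)
    (hT : ∀ N : ℕ, 1 ≤ N → ∀ u : ℕ, (u : ℝ) ≤ θ * N / 2 → ∀ (α β : ℤ → ℝ) (ξ : ℝ),
      AnglesIn ε α (fun _ => ξ) → AnglesIn ε α β →
      θ / 2 * (prodBernoulli (Percolation.gmWeight α fun _ => ξ)).real (cvInitGM N) ≤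
        (prodBernoulli (Percolation.gmWeight α β)).real (cvFinalGM N u))
    {Cs Ct : Set ((ℤ → ℝ) × (ℤ → ℝ))}
    (hsrc : ∀ p ∈ Ct, ∃ ξ : ℝ, (p.1, fun _ => ξ) ∈ Cs ∧ AnglesIn ε p.1 (fun _ => ξ) ∧ AnglesIn ε p.1 p.2)
    (hshift : ∀ p ∈ Ct, ∀ s t : ℤ, ((fun i => p.1 (i - s)), (fun j => p.2 (j - t))) ∈ Ct)
    (hV : (tbLower Cs 1).Nonempty) :
    ∃ cF > (0 : ℝ), ∃ N₂ : ℕ, ∀ N : ℕ, N₂ ≤ N → ∀ p ∈ Ct, ∀ A B : ℤ,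
      cF ≤ (Pgm p.1 p.2).real (tbEvt A B (wFlat θ N) (uFlat θ N)) := by
  obtain ⟨⟨cV, nV⟩, hcV, hVb⟩ := hV
  simp only at hcV hVb
  refine ⟨θ / 2 * cV, by positivity, max nV 1, fun N hN p hp A B => ?_⟩
  have hNV : nV ≤ N := le_trans (le_max_left _ _) hN
  have hN1 : 1 ≤ N := le_trans (le_max_right _ _) hN
  -- at the two base positions
  refine tb_bound_everywhere hshift (A₀ := -((3 * N + uFlat θ N + 2 : ℕ) : ℤ) - 1) (fun q hq => ?_) p hp A B
  obtain ⟨ξ, hs, hξ, hβ⟩ := hsrc q hq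
  have htr := hT N hN1 (uFlat θ N) (uFlat_le hθ.le N) q.1 q.2 ξ hξ hβ
  -- the source side
  have b1 : cV ≤ (Pgm q.1 fun _ => ξ).real (cvInitGM N) := by
    refine (hVb (q.1, fun _ => ξ) hs N hNV (-(N : ℤ)) 0).trans ?_
    rw [one_mul]
    refine measureReal_le_of_subset_ae _ _ fun ω hω h => embTBCrossing_subset_cvInitGM N hω ?_
    have h' : ω ∈ tbEvt (-(N : ℤ)) 0 (2 * N) N := tbEvt_mono_width (le_refl _) (by push_cast; omega) h
    unfold tbEvt at h'
    convert h' using 2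
    · funext v; push_cast; ring
    · push_cast; ring
  have step : θ / 2 * cV ≤ (Pgm q.1 q.2).real (cvFinalGM N (uFlat θ N)) :=
    (mul_le_mul_of_nonneg_left b1 (by positivity)).trans htr
  -- the target side, at the two positions
  have tgt : ∀ A₀' : ℤ, A₀' = -((3 * N + uFlat θ N + 2 : ℕ) : ℤ) - 1 ∨ A₀' = -((3 * N + uFlat θ N + 2 : ℕ) : ℤ) - 1 + 1 →
      (Pgm q.1 q.2).real (cvFinalGM N (uFlat θ N)) ≤ (Pgm q.1 q.2).real (tbEvt A₀' 0 (wFlat θ N) (uFlat θ N)) := by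
    intro A₀' hA
    refine measureReal_le_of_subset_ae _ _ fun ω _ h => ?_
    have h1 := cvFinalGM_subset_embTBCrossing N (uFlat θ N) h
    have h2 : ω ∈ tbEvt (-((3 * N + uFlat θ N + 2 : ℕ) : ℤ)) 0 (2 * (3 * N + uFlat θ N + 2)) (uFlat θ N) := by
      unfold tbEvt; convert h1 using 2
      · funext v; push_cast; ring
      · push_cast; ring
    refine tbEvt_mono_width ?_ ?_ h2
    · rcases hA with rfl | rfl <;> omega
    · unfold wFlat; rcases hA with rfl | rfl <;> push_cast <;> omega
  exact ⟨step.trans (tgt _ (Or.inl rfl)), step.trans (tgt _ (Or.inr rfl))⟩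

/-! ### Stacking -/

/-- The transposed class of a shift-invariant class is shift invariant. [folklore] -/
theorem shift_transpC {Ct : Set ((ℤ → ℝ) × (ℤ → ℝ))}
    (hshift : ∀ p ∈ Ct, ∀ s t : ℤ, ((fun i => p.1 (i - s)), (fun j => p.2 (j - t))) ∈ Ct) :
    ∀ p ∈ transpC Ct, ∀ s t : ℤ, ((fun i => p.1 (i - s)), (fun j => p.2 (j - t))) ∈ transpC Ct := by
  intro p hp s t
  simp only [transpC, Set.mem_setOf_eq] at hp ⊢
  exact hshift _ hp t s

/-- Arithmetic of the stacking constants (all linear after the substitutions). [folklore] -/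
theorem stacking_arith {θ : ℝ} (hθ1 : θ ≤ 1) {T N u c nC m : ℕ} (hTθ : 1 ≤ θ * T)
    (hN : 28 * T + 6 * (nC + 1) * T + 3 ≤ N) (hu1 : (u : ℝ) ≤ θ * N / 2) (hu2 : θ * N / 2 - 1 ≤ (u : ℝ))
    (hc1 : 3 * c ≤ u) (hc2 : u ≤ 3 * c + 2) (hNm : 9 * N ≤ m) (hmN : m < 9 * (N + 1)) (hm : 30 + 200 * T ≤ m) :
    1 ≤ c ∧ nC ≤ c ∧ 6 * N + 2 * u + 5 ≤ (60 * T + 1) * c ∧ 6 * N + 2 * u + 5 ≤ m ∧ 2 * m ≤ 150 * T * c + u := by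
  have rN : (28 * T + 6 * (nC + 1) * T + 3 : ℝ) ≤ N := by exact_mod_cast hN
  have rc1 : (3 * c : ℝ) ≤ u := by exact_mod_cast hc1
  have rc2 : (u : ℝ) ≤ 3 * c + 2 := by exact_mod_cast hc2
  have rNm : (9 * N : ℝ) ≤ m := by exact_mod_cast hNm
  have rmN : (m : ℝ) < 9 * (N + 1) := by exact_mod_cast hmN
  have rm : (30 + 200 * T : ℝ) ≤ m := by exact_mod_cast hm
  have hT0 : (0 : ℝ) ≤ T := Nat.cast_nonneg T
  have hN0 : (0 : ℝ) ≤ N := Nat.cast_nonneg N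
  have hθN : (N : ℝ) ≤ θ * T * N := by nlinarith
  have hθTN : θ * N * T ≥ N := by nlinarith
  have huN : (u : ℝ) ≤ N / 2 := by nlinarith
  refine ⟨?_, ?_, ?_, ?_, ?_⟩
  · have : (1 : ℝ) ≤ c := by nlinarith
    exact_mod_cast this
  · have : (nC : ℝ) ≤ c := by nlinarith
    exact_mod_cast this
  · have : (6 * N + 2 * u + 5 : ℝ) ≤ (60 * T + 1) * c := by nlinarith
    exact_mod_cast this
  · have : (6 * N + 2 * u + 5 : ℝ) ≤ m := by nlinarith
    exact_mod_cast this
  · have : (2 * m : ℝ) ≤ 150 * T * c + u := by nlinarith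
    exact_mod_cast this

/-- **Proposition 6.1, vertical half (stacking).** With the conclusion of Prop. 6.8 for a constant
`θ ∈ (0, 1]`, a source class with bounds for vertical crossings of squares, and a shift-invariant
target class with sources as in `lrLower_of_hTransport` which already has left–right bounds of
every aspect ratio, the target class has uniform bounds for top–bottom crossings of `n × 2n`
boxes: flat vertical crossings (`flat_tbBound`) are stacked, consecutive ones being glued by long
horizontal crossings of the overlaps — chaining in the transposed class.
[cite: GrimmettManolescu2014Isoradial, §6.1 Prop. 6.1 (via Lemma 4.3 (b)), §6.3 Prop. 6.8] -/
theorem tbLower_of_vTransport {ε θ : ℝ} (hθ : 0 < θ) (hθ1 : θ ≤ 1)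
    (hT : ∀ N : ℕ, 1 ≤ N → ∀ u : ℕ, (u : ℝ) ≤ θ * N / 2 → ∀ (α β : ℤ → ℝ) (ξ : ℝ),
      AnglesIn ε α (fun _ => ξ) → AnglesIn ε α β →
      θ / 2 * (prodBernoulli (Percolation.gmWeight α fun _ => ξ)).real (cvInitGM N) ≤
        (prodBernoulli (Percolation.gmWeight α β)).real (cvFinalGM N u))
    {Cs Ct : Set ((ℤ → ℝ) × (ℤ → ℝ))}
    (hsrc : ∀ p ∈ Ct, ∃ ξ : ℝ, (p.1, fun _ => ξ) ∈ Cs ∧ AnglesIn ε p.1 (fun _ => ξ) ∧ AnglesIn ε p.1 p.2)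
    (hshift : ∀ p ∈ Ct, ∀ s t : ℤ, ((fun i => p.1 (i - s)), (fun j => p.2 (j - t))) ∈ Ct)
    (hV : (tbLower Cs 1).Nonempty) (hH : ∀ ρ, 1 ≤ ρ → (lrLower Ct ρ).Nonempty) :
    (tbLower Ct 2).Nonempty := by
  -- constants
  set T : ℕ := ⌈1 / θ⌉₊ with hT'
  have hTθ : 1 ≤ θ * T := by
    have h1 : 1 / θ ≤ T := Nat.le_ceil _
    have := mul_le_mul_of_nonneg_left h1 hθ.le
    rwa [mul_one_div_cancel hθ.ne'] at this
  have hT1 : (1 : ℝ) ≤ T := by nlinarith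
  obtain ⟨cF, hcF, N₂, hF⟩ := flat_tbBound hθ hT hsrc hshift hV
  obtain ⟨⟨cC, nC⟩, hcC, hCb⟩ := hH (60 * T + 1) (by omega)
  simp only at hcC hCb
  set K : ℕ := 150 * T with hK
  set Nmin : ℕ := max N₂ (28 * T + 6 * (nC + 1) * T + 3) with hNmin
  -- the witness, in the transposed class
  suffices hD : ((cF ^ (K + 1) * cC ^ K, 9 * (Nmin + 1) + 30 + 200 * T) : ℝ × ℕ) ∈ lrLower (transpC Ct) 2 from
    ⟨_, tbLower_of_lrLower_transp hD⟩
  refine ⟨by positivity, fun p' hp' m hm A B => ?_⟩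
  simp only at hm ⊢
  set p : (ℤ → ℝ) × (ℤ → ℝ) := (fun i => -p'.2 i, fun j => -p'.1 j) with hp
  have hpC : p ∈ Ct := hp'
  -- scales
  set N : ℕ := m / 9 with hN
  have hNm : 9 * N ≤ m := by rw [hN, mul_comm]; exact Nat.div_mul_le_self m 9
  have hmN : m < 9 * (N + 1) := by rw [hN]; omega
  have hNmin : Nmin + 1 ≤ N := by rw [hN]; omega
  have hN₂ : N₂ ≤ N := by omega
  have hN28 : 28 * T + 6 * (nC + 1) * T + 3 ≤ N := by omega
  set u : ℕ := uFlat θ N with hu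
  set W : ℕ := wFlat θ N with hW
  set c : ℕ := u / 3 with hc
  have hu1 : (u : ℝ) ≤ θ * N / 2 := uFlat_le hθ.le N
  have hu2 : θ * N / 2 - 1 ≤ (u : ℝ) := uFlat_ge θ N
  have hc1 : 3 * c ≤ u := by rw [hc]; omega
  have hc2 : u ≤ 3 * c + 2 := by rw [hc]; omega
  have hWdef : W = 6 * N + 2 * u + 5 := by rw [hW, wFlat, ← hu]; ring
  have hm30 : 30 + 200 * T ≤ m := by omega
  obtain ⟨hA, hCc, hB, hDm, hE⟩ := stacking_arith hθ1 hTθ hN28 hu1 hu2 hc1 hc2 hNm hmN hm30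
  rw [← hWdef] at hB hDm
  rw [← hK] at hE
  -- freeze the constants (no unfolding of `⌈1/θ⌉₊`, `⌊θN/2⌋₊` in definitional checks below)
  clear_value c W u N K T
  -- the chain in the transposed class
  have key := prod_le_measureReal_chain (a := fun j => A + j * c) (B := B) (B' := B) (w := u) (c := c) (h := W) (h' := W)
    p'.1 p'.2 (by omega) (by rw [hWdef]; omega) (by omega) (fun j => by push_cast; nlinarith)
    (fun j => by push_cast; nlinarith) le_rfl le_rfl K
  -- lower bounds for the pieces
  have e1 : (fun i => (0 : ℝ) - p'.2 i) = p.1 := by funext i; rw [hp, zero_sub]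
  have e2 : (fun j => (0 : ℝ) - p'.1 j) = p.2 := by funext i; rw [hp, zero_sub]
  have bH : ∀ j, cF ≤ (Pgm p'.1 p'.2).real (hBox (fun j => A + j * c) B u W j) := by
    intro j
    have h1 := hF N hN₂ p hpC B (A + j * c)
    rw [← hW, ← hu] at h1
    rw [hBox, measureReal_embRectCrossing_transp_int p'.1 p'.2 0, e1, e2]
    exact h1
  have bV : ∀ j, cC ≤ (Pgm p'.1 p'.2).real (vBox (fun j => A + j * c) B c W j) := by
    intro j
    have h1 := hCb p hpC c hCc B (A + (j + 1 : ℕ) * c)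
    rw [vBox, measureReal_embTBCrossing_transp_int p'.1 p'.2 0, e1, e2]
    have iB : (W : ℤ) ≤ ((60 * T + 1) * c : ℕ) := by exact_mod_cast hB
    have iB' : B + (W : ℤ) ≤ B + ((60 * T + 1) * c : ℕ) := by linarith [iB]
    have hsub : ∀ ω : Set (Sym2 (Site 2)), ω ⊆ (zdGraph 2).edgeSet → ω ∈ lrEvt B (A + (j + 1 : ℕ) * c) ((60 * T + 1) * c) c →
        ω ∈ lrEvt B (A + (j + 1 : ℕ) * c) W c :=
      fun ω hω h => lrEvt_anti_width (A := B) (A' := B) (B := A + (j + 1 : ℕ) * c) (a := W) (a' := (60 * T + 1) * c) (b := c)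
        (le_refl _) iB' hω h
    exact h1.trans (measureReal_le_of_subset_ae p.1 p.2 hsub)
  have hprod : cF ^ (K + 1) * cC ^ K ≤
      (∏ j ∈ Finset.range (K + 1), (Pgm p'.1 p'.2).real (hBox (fun j => A + j * c) B u W j)) *
        ∏ j ∈ Finset.range K, (Pgm p'.1 p'.2).real (vBox (fun j => A + j * c) B c W j) := by
    have h1 : cF ^ (K + 1) ≤ ∏ j ∈ Finset.range (K + 1), (Pgm p'.1 p'.2).real (hBox (fun j => A + j * c) B u W j) :=
      calc cF ^ (K + 1) = ∏ _j ∈ Finset.range (K + 1), cF := by rw [Finset.prod_const, Finset.card_range]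
        _ ≤ _ := Finset.prod_le_prod (fun _ _ => hcF.le) fun j _ => bH j
    have h2 : cC ^ K ≤ ∏ j ∈ Finset.range K, (Pgm p'.1 p'.2).real (vBox (fun j => A + j * c) B c W j) :=
      calc cC ^ K = ∏ _j ∈ Finset.range K, cC := by rw [Finset.prod_const, Finset.card_range]
        _ ≤ _ := Finset.prod_le_prod (fun _ _ => hcC.le) fun j _ => bV j
    have h3 : (0 : ℝ) ≤ cC ^ K := pow_nonneg hcC.le K
    have h4 : (0 : ℝ) ≤ ∏ j ∈ Finset.range (K + 1), (Pgm p'.1 p'.2).real (hBox (fun j => A + j * c) B u W j) :=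
      Finset.prod_nonneg fun _ _ => measureReal_nonneg
    exact mul_le_mul h1 h2 h3 h4
  refine hprod.trans (key.trans (measureReal_le_of_subset_ae _ _ fun ω hω h => ?_))
  -- from the long box to the `2m × m` box
  have h0 : ω ∈ lrEvt A B (K * c + u) W := by
    unfold lrEvt; convert h using 2 <;> first | (funext v; push_cast; ring) | (push_cast; ring)
  have iE : (2 * m : ℤ) ≤ ((K * c + u : ℕ) : ℤ) := by exact_mod_cast hE
  have iD : (W : ℤ) ≤ m := by exact_mod_cast hDm
  have h1 : ω ∈ lrEvt A B (2 * m) W := lrEvt_anti_width (le_refl _) (by push_cast at iE ⊢; linarith) hω h0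
  exact lrEvt_mono_height (le_refl _) (by linarith) h1

end TrackExchange

end Literature.Probability.Percolation
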